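import Summits.HubbardSuperconductivity.HubbardSuperconductivity.Theorems.MesoscopicPairOrder.Negative.PolarisedExclusion
import Literature.MathematicalPhysics.QuantumLattice.HubbardGroundStateDoublonBound
import Literature.MathematicalPhysics.QuantumLattice.HubbardPairDensityCouplingFloor
import Literature.MathematicalPhysics.QuantumLattice.FreeFermionSectorEnergyDeviation
import Literature.MathematicalPhysics.QuantumLattice.TorusCooperSum
import Literature.MathematicalPhysics.QuantumLattice.ReducedBCSTorus
import Literature.MathematicalPhysics.QuantumLattice.XYOrderDischarges
import HarnessLib

/-!
# Crux `MesoscopicPairOrder` (stmt-HubbardSuperconductivity-7331), Negative side: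
# a STONER-TYPE SPIN CEILING for sector ground states of the repulsive Hubbard torus

Line `redirect_birth` (lead c9). The refuter instruments against the crux body and against stub (Q)
(`PolarisedExclusion.pointwise_false_of_nearlySaturated`, `FluctuationFloorPosition.fluctuationFloorAt_false_of_nearlySaturated`)
fire on NEARLY SATURATED sector ground states (spin deficiency `n - S = o(L²)`); the tree excludes only
FULL saturation (`NoSaturationEnvelope`, one spin flip, an `O(1)` energy gain). This file proves the
variational mechanism that makes the spin deficiency EXTENSIVE at weak coupling: every unit trial vector
of the sector caps the total spin of every ground multiplet.

For `H = hubbardTorus 2 L 1 U`, `U ≥ 0`, `L ≥ 3`, a ground state `ψ` of the `(2n, S^z = 0)` sector with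
`S² ψ = S(S+1) ψ`, `S ≤ n`:

* `sum_torusBand_eq_zero` — `Σ_k ε_L(k) = 0` (`L ≥ 2`).
* `re_expect_hubbardTorus_zero_ge_polarised` — on Lieb's sector `(a, b)` the kinetic energy is at least
  `(-4(L² - a) - 4b)‖φ‖²` (`ε ≤ 4` on the `↑` holes, `ε ≥ -4` on the `↓` electrons, `Σ_k ε = 0`).
* `eight_spin_le_of_groundState` — **`8S ≤ 4L² + E₀`**, `E₀ = minEnergyOn H (szSector (2n) 0)`: the top
  member `(S⁺)^S ψ` of the multiplet lies in `(n + S, n - S)` with the same Rayleigh quotient `E₀`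
  (`IsSu2Triple.re_form_P_pow_eq`, `[H, S⁻] = 0`), the interaction is `≥ 0`, and the kinetic bound applies.
* `eight_spin_le_of_trial` — hence `8S ≤ 4L² + Re⟨Φ, HΦ⟩` for every unit `Φ ∈ szSector (2n) 0`.
* `re_expect_interaction_le_down` — `Re⟨φ, Σ_x n_{x↑}n_{x↓} φ⟩ ≤ b‖φ‖²` on the sector `(a, b)` (crude doublon bound).
* `eight_spin_le_of_pairedSea` — with the paired Fermi sea `Φ_l = Π_{k∈l} b_k† |0⟩` over ANY `n` momenta:
  **`8S ≤ 4L² + 2 Σ_{k∈l} ε_L(k) + U·n`** — the Stoner criterion in the tree's vocabulary: a trial sea with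
  `2 Σ_l ε ≤ -(4 - 8ν + Uν + 8κ) L²` (`ν = n/L²`) forces the deficiency `n - S ≥ κ L²` of every multiplet.

The lattice-sum evaluation (a momentum square as trial sea: `2Σ ε ≈ -(8/π)√ν sin(π√ν) L²`) and the
resulting extensive deficiency on `U ≤ 1/2`, `δ ∈ [1/10, 3/10]` are in the companion file
`StonerSquareSea.lean`. Sources: E. C. Stoner, Proc. R. Soc. A 165 (1938) 372 (the criterion);
E. H. Lieb, PRL 62 (1989) 1201 (sectors `(a, b)`); H. Tasaki, Prog. Theor. Phys. 99 (1998) 489, §5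
(variational bounds against ferromagnetism); E. H. Lieb, M. Loss, *Analysis* (2001) Thm 1.14 (bathtub).
Folklore finite-dimensional statements; no definition, no named fact, no sorry.
-/

noncomputable section

-- the summit namespace repeats the problem name by design (D-0017)
set_option linter.dupNamespace false

namespace Summit.HubbardSuperconductivity.HubbardSuperconductivity.Theorems.MesoscopicPairOrder.Negative

open Matrix Finset Filter
open Literature.Probability.LatticeModels Literature.MathematicalPhysics.QuantumLattice
open scoped ComplexOrder ComplexConjugate

section Stoner

variable {L : ℕ} [NeZero L]

/-! ### The band sums to zero -/

/-- `Σ_k cos(p_i(k)) = 0` over the `L × L` torus for each coordinate `i` (`L ≥ 2`): the real part of the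
character orthogonality `Σ_q χ_q(e_i) = L² δ_{e_i, 0}` (`sum_torusChar`, `torusChar_single_re`). [folklore] -/
theorem sum_cos_latticeMomentum_eq_zero (hL : 2 ≤ L) (i : Fin 2) :
    ∑ k : TorusSite 2 L, Real.cos (latticeMomentum L k i) = 0 := by
  haveI : Fact (1 < L) := ⟨hL⟩
  have hw : (Pi.single i 1 : TorusSite 2 L) ≠ 0 := fun h => by
    have := congrFun h i
    rw [Pi.single_eq_same, Pi.zero_apply] at this
    exact one_ne_zero this
  have h := congrArg Complex.re (sum_torusChar L (Pi.single i 1 : TorusSite 2 L))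
  rw [if_neg hw, Complex.zero_re, Complex.re_sum] at h
  simp_rw [torusChar_single_re] at h
  exact h

/-- **`Σ_k ε_L(k) = 0`** on the `L × L` torus, `L ≥ 2`: `ε_L(k) = -2(cos(2πk₁/L) + cos(2πk₂/L))` and each
full-period cosine sum vanishes. [folklore] -/
theorem sum_torusBand_eq_zero (hL : 2 ≤ L) : ∑ k : TorusSite 2 L, torusBand L k = 0 := by
  unfold torusBand
  rw [← Finset.mul_sum, Finset.sum_comm]
  simp only [sum_cos_latticeMomentum_eq_zero hL, Finset.sum_const_zero, mul_zero]

/-! ### Kinetic energy on a polarised sector -/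

/-- **Kinetic energy on Lieb's sector `(a, b)` is at least `-4(L² - a) - 4b` per unit norm** (`L ≥ 3`):
`Re⟨φ, H₀ φ⟩ = Σ_k ε_k (x_k↑ + x_k↓)` with Bloch occupations `0 ≤ x_kσ ≤ ‖φ‖²`, `Σ_k x_k↑ = a‖φ‖²`,
`Σ_k x_k↓ = b‖φ‖²`; the `↑` part is `Σ_k (ε_k - 4) x_k↑ + 4a‖φ‖² ≥ Σ_k (ε_k - 4)‖φ‖² + 4a‖φ‖² = (4a - 4L²)‖φ‖²`
(`ε_k ≤ 4`, `Σ_k ε_k = 0`), the `↓` part is `≥ -4b‖φ‖²` (`ε_k ≥ -4`). For `a` close to `L²` (few `↑` holes)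
this is the bathtub bound up to the band edge. Lieb–Loss (2001) Thm 1.14; BGM 2006 §1.2. [folklore] -/
theorem re_expect_hubbardTorus_zero_ge_polarised (hL : 3 ≤ L) {a b : ℕ}
    {φ : Fock (Orb (FermionTorus 2 L))} (hφ : IsInSector a b φ) :
    (-(4 : ℝ) * ((L : ℝ) ^ 2 - a) - 4 * b) * (star φ ⬝ᵥ φ).re ≤
      (star φ ⬝ᵥ (hubbardTorus 2 L 1 0 *ᵥ φ)).re := by
  rw [hubbardTorus_zero_eq_sum_momentumNumber hL, Matrix.sum_mulVec, dotProduct_sum, Complex.re_sum]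
  have hsplit : ∀ k : TorusSite 2 L,
      (star φ ⬝ᵥ ((∑ σ : Fin 2, ((torusBand L k : ℝ) : ℂ) • momentumNumber k σ) *ᵥ φ)).re =
        torusBand L k * (star φ ⬝ᵥ (momentumNumber k 0 *ᵥ φ)).re +
          torusBand L k * (star φ ⬝ᵥ (momentumNumber k 1 *ᵥ φ)).re := by
    intro k
    rw [Matrix.sum_mulVec, dotProduct_sum, Complex.re_sum, Fin.sum_univ_two]
    simp only [Fin.isValue, Matrix.smul_mulVec, dotProduct_smul, smul_eq_mul, Complex.re_ofReal_mul]
  simp only [hsplit, Finset.sum_add_distrib]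
  -- the two occupation sums and their bounds
  have hup := sum_re_expect_momentumNumber_up hφ
  have hdown := sum_re_expect_momentumNumber_down hφ
  have hcard : (Finset.univ : Finset (TorusSite 2 L)).card = L ^ 2 := by
    simp [Finset.card_univ, Fintype.card_pi, ZMod.card]
  have h0 : ∑ k : TorusSite 2 L, torusBand L k = 0 := sum_torusBand_eq_zero (by omega)
  -- `↑`: `Σ ε x ≥ Σ (ε - 4)‖φ‖² + 4 a ‖φ‖²`
  have h1 : ∑ k : TorusSite 2 L, (torusBand L k - 4) * (star φ ⬝ᵥ φ).re + 4 * (a * (star φ ⬝ᵥ φ).re) ≤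
      ∑ k : TorusSite 2 L, torusBand L k * (star φ ⬝ᵥ (momentumNumber k 0 *ᵥ φ)).re := by
    rw [← hup, Finset.mul_sum, ← Finset.sum_add_distrib]
    refine Finset.sum_le_sum fun k _ => ?_
    have hx := re_expect_momentumNumber_mem_Icc k 0 φ
    have hε := torusBand_le_four L k
    nlinarith [hx.1, hx.2]
  have h1' : ∑ k : TorusSite 2 L, (torusBand L k - 4) * (star φ ⬝ᵥ φ).re =
      -(4 : ℝ) * (L : ℝ) ^ 2 * (star φ ⬝ᵥ φ).re := by
    rw [← Finset.sum_mul, Finset.sum_sub_distrib, h0, Finset.sum_const, hcard]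
    simp only [nsmul_eq_mul]
    push_cast
    ring
  -- `↓`: `Σ ε x ≥ -4 b ‖φ‖²`
  have h2 : -(4 : ℝ) * (b * (star φ ⬝ᵥ φ).re) ≤
      ∑ k : TorusSite 2 L, torusBand L k * (star φ ⬝ᵥ (momentumNumber k 1 *ᵥ φ)).re := by
    rw [← hdown, Finset.mul_sum]
    refine Finset.sum_le_sum fun k _ => ?_
    have hx := re_expect_momentumNumber_mem_Icc k 1 φ
    have hε := neg_four_le_torusBand L k
    nlinarith [hx.1, hx.2]
  rw [h1'] at h1
  linarith

/-! ### The spin ceiling -/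

/-- **STONER-TYPE SPIN CEILING.** For `U ≥ 0`, `L ≥ 3` and a ground state `ψ` of the `(2n, S^z = 0)` sector
of `H = hubbardTorus 2 L 1 U` with `S² ψ = S(S+1) ψ`, `S ≤ n`:  `8 S ≤ 4 L² + E₀`,
`E₀ = minEnergyOn H (szSector (2n) 0)`. Proof: the top member `φ = (S⁺)^S ψ` lies in Lieb's sector
`(n + S, n - S)` and has the Rayleigh quotient `E₀` of `ψ` (`[H, S⁻] = 0`, `IsSu2Triple.re_form_P_pow_eq`);
there `E₀‖φ‖² = Re⟨φ, Hφ⟩ ≥ Re⟨φ, H₀φ⟩ ≥ (-4(L² - n - S) - 4(n - S))‖φ‖² = (8S - 4L²)‖φ‖²`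
(`re_expect_hubbardTorus_zero_ge_polarised`, interaction `≥ 0`). Stoner (1938); Lieb (1989);
Tasaki (1998) §5. [folklore] -/
theorem eight_spin_le_of_groundState (hL : 3 ≤ L) {U : ℝ} (hU : 0 ≤ U) {n S : ℕ} (hS : S ≤ n)
    {ψ : Fock (Orb (FermionTorus 2 L))} (hgs : IsGroundStateInSector (hubbardTorus 2 L 1 U) (2 * n) 0 ψ)
    (hspin : spinSq *ᵥ ψ = (((S : ℝ) * ((S : ℝ) + 1) : ℝ) : ℂ) • ψ) :
    8 * (S : ℝ) ≤ 4 * (L : ℝ) ^ 2 +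
      (hubbardTorus 2 L 1 U).minEnergyOn (szSector (Λ := FermionTorus 2 L) (2 * n) 0) := by
  obtain ⟨hmem, hne, hHψ⟩ := hgs
  have hsec : IsInSector n n ψ := (mem_szSector_two_mul_zero_iff n ψ).1 hmem
  set H := hubbardTorus 2 L 1 U with hH_def
  set E₀ : ℝ := H.minEnergyOn (szSector (Λ := FermionTorus 2 L) (2 * n) 0) with hE₀
  -- the `su(2)` data and the top member
  have htri := LiebTwo.isSu2Triple_spin (Λ := FermionTorus 2 L)
  have hZ0 : HubbardWave0.spinZ *ᵥ ψ = 0 := by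
    rw [LiebThm1.spinZ_mulVec_of_isInSector hsec, sub_self, mul_zero, zero_smul]
  have hC : su2Casimir spinPlus spinMinus HubbardWave0.spinZ *ᵥ ψ = ((S : ℂ) * (S + 1)) • ψ := by
    rw [LiebTwo.su2Casimir_spin_eq_spinSq, hspin]
    push_cast
    rfl
  set φ : Fock (Orb (FermionTorus 2 L)) := spinPlus ^ S *ᵥ ψ with hφ_def
  have hφsec : IsInSector (n + S) (n - S) φ := isInSector_spinPlus_pow_mulVec hsec S hS
  set c : ℝ := ((∏ i ∈ Finset.range S, ((S - i) * (S + i + 1)) : ℕ) : ℝ) with hc_def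
  have hc : 0 < c := by rw [hc_def]; exact_mod_cast ladderProd_pos S
  have hcomm : Commute H Literature.MathematicalPhysics.QuantumLattice.spinMinus :=
    LiebThm1.hamiltonian_commute_spinMinus (fermionTorusGraph 2 L) 1 U
  have hHφ : (star φ ⬝ᵥ (H *ᵥ φ)).re = c * (star ψ ⬝ᵥ (H *ᵥ ψ)).re :=
    su2_re_form_P_pow_eq htri H hcomm hZ0 S hC
  have hnφ : (star φ ⬝ᵥ φ).re = c * (star ψ ⬝ᵥ ψ).re := su2_re_normSq_P_pow_eq htri hZ0 S hC
  -- `Re⟨ψ, Hψ⟩ = E₀ ‖ψ‖²`, `‖ψ‖² > 0`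
  have hEψ : (star ψ ⬝ᵥ (H *ᵥ ψ)).re = E₀ * (star ψ ⬝ᵥ ψ).re := by
    rw [hHψ, dotProduct_smul, smul_eq_mul, Complex.re_ofReal_mul]
  have hnψ : 0 < (star ψ ⬝ᵥ ψ).re := by
    have h := Matrix.dotProduct_star_self_pos_iff.2 hne
    exact (Complex.pos_iff.1 h).1
  -- lower bound at the top member: kinetic + interaction ≥ 0
  have hkin := re_expect_hubbardTorus_zero_ge_polarised hL hφsec
  have hint := (re_expect_interaction_torus_mem_Icc φ).1
  have hsplit : (star φ ⬝ᵥ (H *ᵥ φ)).re =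
      (star φ ⬝ᵥ (hubbardTorus 2 L 1 0 *ᵥ φ)).re +
        U * (star φ ⬝ᵥ ((∑ x : FermionTorus 2 L, numberOp x 0 * numberOp x 1 :
          Matrix (Finset (Orb (FermionTorus 2 L))) _ ℂ) *ᵥ φ)).re := by
    rw [hH_def, hubbardTorus_eq_zero_add_smul_interaction U, add_mulVec, Matrix.smul_mulVec, dotProduct_add,
      dotProduct_smul, smul_eq_mul, Complex.add_re, Complex.re_ofReal_mul]
  have hlow : (-(4 : ℝ) * ((L : ℝ) ^ 2 - ((n + S : ℕ) : ℝ)) - 4 * ((n - S : ℕ) : ℝ)) * (star φ ⬝ᵥ φ).re ≤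
      (star φ ⬝ᵥ (H *ᵥ φ)).re := by
    rw [hsplit]
    nlinarith [hkin, hint, mul_nonneg hU hint]
  -- combine: `(8S - 4L²) c ‖ψ‖² ≤ E₀ c ‖ψ‖²`
  rw [hHφ, hEψ, hnφ] at hlow
  have hcast : ((n + S : ℕ) : ℝ) = n + S := by push_cast; ring
  have hcast' : ((n - S : ℕ) : ℝ) = n - S := by rw [Nat.cast_sub hS]
  rw [hcast, hcast'] at hlow
  have hpos : 0 < c * (star ψ ⬝ᵥ ψ).re := mul_pos hc hnψ
  have key : (8 * (S : ℝ) - 4 * (L : ℝ) ^ 2) * (c * (star ψ ⬝ᵥ ψ).re) ≤ E₀ * (c * (star ψ ⬝ᵥ ψ).re) := by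
    have e : (-(4 : ℝ) * ((L : ℝ) ^ 2 - (n + S)) - 4 * (n - S)) = 8 * (S : ℝ) - 4 * (L : ℝ) ^ 2 := by ring
    rw [e] at hlow
    calc (8 * (S : ℝ) - 4 * (L : ℝ) ^ 2) * (c * (star ψ ⬝ᵥ ψ).re)
        = (8 * (S : ℝ) - 4 * (L : ℝ) ^ 2) * (c * (star ψ ⬝ᵥ ψ).re) := rfl
      _ ≤ c * (E₀ * (star ψ ⬝ᵥ ψ).re) := hlow
      _ = E₀ * (c * (star ψ ⬝ᵥ ψ).re) := by ring
  have := le_of_mul_le_mul_right key hpos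
  linarith

/-- **Every unit trial vector caps the spin of every ground multiplet**: with `Φ ∈ szSector (2n) 0`,
`‖Φ‖ = 1`, `8 S ≤ 4 L² + Re⟨Φ, HΦ⟩` (variational principle `E₀ ≤ Re⟨Φ, HΦ⟩`). [folklore] -/
theorem eight_spin_le_of_trial (hL : 3 ≤ L) {U : ℝ} (hU : 0 ≤ U) {n S : ℕ} (hS : S ≤ n)
    {ψ : Fock (Orb (FermionTorus 2 L))} (hgs : IsGroundStateInSector (hubbardTorus 2 L 1 U) (2 * n) 0 ψ)
    (hspin : spinSq *ᵥ ψ = (((S : ℝ) * ((S : ℝ) + 1) : ℝ) : ℂ) • ψ)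
    {Φ : Fock (Orb (FermionTorus 2 L))} (hΦ : Φ ∈ szSector (Λ := FermionTorus 2 L) (2 * n) 0)
    (hΦ1 : star Φ ⬝ᵥ Φ = 1) :
    8 * (S : ℝ) ≤ 4 * (L : ℝ) ^ 2 + (star Φ ⬝ᵥ (hubbardTorus 2 L 1 U *ᵥ Φ)).re := by
  have h := eight_spin_le_of_groundState hL hU hS hgs hspin
  have hH : (hubbardTorus 2 L 1 U).IsHermitian := LiebThm1.hamiltonian_isHermitian _ 1 U
  have hvar := minEnergyOn_le_rayleigh_of_mem hH _ hΦ hΦ1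
  linarith

/-! ### The paired Fermi sea as the trial vector -/

omit [NeZero L] in
/-- **Crude doublon bound on a sector**: `Re⟨φ, Σ_x n_{x↑}n_{x↓} φ⟩ ≤ b · ‖φ‖²` for `φ` in Lieb's sector
`(a, b)` (`n_{x↑}n_{x↓} ≤ n_{x↓}` entrywise — both are diagonal in the configuration basis — and
`Σ_x n_{x↓} = b` on the sector). [folklore] -/
theorem re_expect_interaction_le_down {a b : ℕ} {φ : Fock (Orb (FermionTorus 2 L))}
    (hφ : IsInSector a b φ) :
    (star φ ⬝ᵥ ((∑ x : FermionTorus 2 L, numberOp x 0 * numberOp x 1 :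
        Matrix (Finset (Orb (FermionTorus 2 L))) _ ℂ) *ᵥ φ)).re ≤ b * (star φ ⬝ᵥ φ).re := by
  classical
  -- the interaction is diagonal: `(Σ_x n_x↑ n_x↓ φ) s = #{x : ↑x ∈ s ∧ ↓x ∈ s} · φ s`
  have happly : ∀ s : Finset (Orb (FermionTorus 2 L)),
      ((∑ x : FermionTorus 2 L, numberOp x 0 * numberOp x 1 :
        Matrix (Finset (Orb (FermionTorus 2 L))) _ ℂ) *ᵥ φ) s =
        ((Finset.univ.filter fun x : FermionTorus 2 L => orb x 0 ∈ s ∧ orb x 1 ∈ s).card : ℂ) * φ s := by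
    intro s
    rw [Matrix.sum_mulVec, Finset.sum_apply]
    simp only [LiebThm1.numberOp_eq_diagonal, diagonal_mul_diagonal, mulVec_diagonal]
    rw [← Finset.sum_mul]
    congr 1
    rw [Finset.card_filter]
    push_cast
    refine Finset.sum_congr rfl fun x _ => ?_
    by_cases h0 : orb x 0 ∈ s <;> by_cases h1 : orb x 1 ∈ s <;> simp [h0, h1]
  -- pass to the real sum over configurations
  have hre : (star φ ⬝ᵥ ((∑ x : FermionTorus 2 L, numberOp x 0 * numberOp x 1 :
        Matrix (Finset (Orb (FermionTorus 2 L))) _ ℂ) *ᵥ φ)).re =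
      ∑ s, ((Finset.univ.filter fun x : FermionTorus 2 L => orb x 0 ∈ s ∧ orb x 1 ∈ s).card : ℝ) *
        ‖φ s‖ ^ 2 := by
    simp only [dotProduct, Pi.star_apply, happly, Complex.re_sum]
    refine Finset.sum_congr rfl fun s _ => ?_
    rw [show star (φ s) * (((Finset.univ.filter fun x : FermionTorus 2 L =>
        orb x 0 ∈ s ∧ orb x 1 ∈ s).card : ℂ) * φ s) =
        ((Finset.univ.filter fun x : FermionTorus 2 L => orb x 0 ∈ s ∧ orb x 1 ∈ s).card : ℂ) *
          (star (φ s) * φ s) by ring]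
    rw [Complex.star_def, Complex.conj_mul', ← Complex.ofReal_natCast, ← Complex.ofReal_pow,
      ← Complex.ofReal_mul, Complex.ofReal_re]
  have hnorm : (star φ ⬝ᵥ φ).re = ∑ s, ‖φ s‖ ^ 2 := by
    simp only [dotProduct, Pi.star_apply, Complex.re_sum]
    refine Finset.sum_congr rfl fun s _ => ?_
    rw [Complex.star_def, Complex.conj_mul', ← Complex.ofReal_pow, Complex.ofReal_re]
  rw [hre, hnorm, Finset.mul_sum]
  refine Finset.sum_le_sum fun s _ => ?_
  by_cases hs : φ s = 0
  · simp [hs]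
  · have h := not_imp_comm.1 (hφ s) hs
    have hle : (Finset.univ.filter fun x : FermionTorus 2 L => orb x 0 ∈ s ∧ orb x 1 ∈ s).card ≤ b := by
      rw [← h.2]
      refine Finset.card_le_card fun x hx => ?_
      rw [Finset.mem_filter] at hx
      rw [mem_downPart]
      exact hx.2.2
    have hle' : ((Finset.univ.filter fun x : FermionTorus 2 L => orb x 0 ∈ s ∧ orb x 1 ∈ s).card : ℝ) ≤ b := by
      exact_mod_cast hle
    exact mul_le_mul_of_nonneg_right hle' (sq_nonneg _)

/-- **THE STONER CRITERION (paired Fermi sea as trial vector).** For `U ≥ 0`, `L ≥ 3`, a ground state `ψ` of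
the `(2n, S^z = 0)` sector of `hubbardTorus 2 L 1 U` with `S² ψ = S(S+1) ψ`, `S ≤ n`, and ANY duplicate-free list
`l` of `n` momenta: `8 S ≤ 4 L² + 2 Σ_{k∈l} ε_L(k) + U·n`. (Trial vector `Φ_l = Π_{k∈l} b_k† |0⟩`: unit,
in the sector, kinetic energy `2 Σ_l ε` (`re_expect_hubbardTorus_zero_pairedState`), at most `n` doublons.)
A trial sea with `2 Σ_l ε ≤ -(4 - 8ν + Uν + 8κ) L²`, `ν = n/L²`, therefore forces the spin deficiency
`n - S ≥ κ L²` of every ground multiplet. Stoner (1938); Tasaki (1998) §5. [folklore] -/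
theorem eight_spin_le_of_pairedSea (hL : 3 ≤ L) {U : ℝ} (hU : 0 ≤ U) {n S : ℕ} (hS : S ≤ n)
    {ψ : Fock (Orb (FermionTorus 2 L))} (hgs : IsGroundStateInSector (hubbardTorus 2 L 1 U) (2 * n) 0 ψ)
    (hspin : spinSq *ᵥ ψ = (((S : ℝ) * ((S : ℝ) + 1) : ℝ) : ℂ) • ψ)
    {l : List (TorusSite 2 L)} (hl : l.Nodup) (hlen : l.length = n) :
    8 * (S : ℝ) ≤ 4 * (L : ℝ) ^ 2 + 2 * ∑ k ∈ l.toFinset, torusBand L k + U * n := by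
  set Φ : Fock (Orb (FermionTorus 2 L)) :=
    (List.prod (List.map (fun k : TorusSite 2 L => (pairMode k)ᴴ) l)) *ᵥ
      (vacuum : Fock (Orb (FermionTorus 2 L))) with hΦ_def
  have hΦmem : Φ ∈ szSector (Λ := FermionTorus 2 L) (2 * n) 0 := by
    have h := pairedState_mem_szSector (L := L) l
    rwa [hlen] at h
  have hΦ1 : star Φ ⬝ᵥ Φ = 1 := star_pairedState_dotProduct_self hl
  have h := eight_spin_le_of_trial hL hU hS hgs hspin hΦmem hΦ1
  -- energy of the trial sea: kinetic `2 Σ_l ε`, interaction `≤ U n`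
  have hkin : (star Φ ⬝ᵥ (hubbardTorus 2 L 1 0 *ᵥ Φ)).re = 2 * ∑ k ∈ l.toFinset, torusBand L k :=
    re_expect_hubbardTorus_zero_pairedState hL hl
  have hsec : IsInSector n n Φ := (mem_szSector_two_mul_zero_iff n Φ).1 hΦmem
  have hint := re_expect_interaction_le_down hsec
  rw [hΦ1, Complex.one_re, mul_one] at hint
  have hsplit : (star Φ ⬝ᵥ (hubbardTorus 2 L 1 U *ᵥ Φ)).re =
      (star Φ ⬝ᵥ (hubbardTorus 2 L 1 0 *ᵥ Φ)).re +
        U * (star Φ ⬝ᵥ ((∑ x : FermionTorus 2 L, numberOp x 0 * numberOp x 1 :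
          Matrix (Finset (Orb (FermionTorus 2 L))) _ ℂ) *ᵥ Φ)).re := by
    rw [hubbardTorus_eq_zero_add_smul_interaction U, add_mulVec, Matrix.smul_mulVec, dotProduct_add,
      dotProduct_smul, smul_eq_mul, Complex.add_re, Complex.re_ofReal_mul]
  rw [hsplit, hkin] at h
  nlinarith [mul_le_mul_of_nonneg_left hint hU]

/-- Registered sub-goal form (line `redirect_birth`, lead c9): the Stoner criterion with the paired Fermi sea
as trial vector, all parameters explicit (`eight_spin_le_of_pairedSea`). [folklore] -/
theorem eightSpinLeOfPairedSea : ∀ {L : ℕ} [NeZero L], 3 ≤ L → ∀ {U : ℝ}, 0 ≤ U → ∀ {n S : ℕ}, S ≤ n → ∀ {ψ : Fock (Orb (FermionTorus 2 L))}, IsGroundStateInSector (hubbardTorus 2 L 1 U) (2 * n) 0 ψ → spinSq *ᵥ ψ = (((S : ℝ) * ((S : ℝ) + 1) : ℝ) : ℂ) • ψ → ∀ {l : List (TorusSite 2 L)}, l.Nodup → l.length = n → 8 * (S : ℝ) ≤ 4 * (L : ℝ) ^ 2 + 2 * ∑ k ∈ l.toFinset, torusBand L k + U * n :=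
  fun hL _ hU _ _ hS _ hgs hspin _ hl hlen => eight_spin_le_of_pairedSea hL hU hS hgs hspin hl hlen

end Stoner

end Summit.HubbardSuperconductivity.HubbardSuperconductivity.Theorems.MesoscopicPairOrder.Negative
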